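import Literature.NumberTheory.GaloisRepresentations.KummerLayerClass
import Literature.NumberTheory.GaloisRepresentations.EmbeddingApproximation
import Literature.NumberTheory.GaloisRepresentations.PrimeRootsNearOne
import HarnessLib

/-!
# Choice of the Kummer radicand by simultaneous approximation

Topic `NumberTheory/GaloisRepresentations`; theorems only (no definition, no named fact).  In the
setting of `KummerLayerClass` (number field `K`, place `v₀`, `k ⊆ K̄` finite over `K`, `ζ ∈ K̄` a
primitive `ℓ`-th root of unity with `k(ζ)` normal over `K`, embedding `ι : K̄ → \bar K_{v₀}`,
`H ⊇ H'`, `Z`, `W = H ⊓ Z`, Kummer generator `β` of the local layer, `b = β ^ ℓ`), and given a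
finite set `V ∌ v₀` of places at which `k` is split (`Γ_{K_u}` fixes `ι_u k`), we produce
`a ∈ k(ζ)`, `a ≠ 0`, with

* (C1) `ι a = b · y ^ ℓ` with `y ≠ 0` fixed by `W`;
* (C2) `ι (γ a)` is the `ℓ`-th power of a `W`-fixed element for every `γ ∈ Gal(K̄/k)` that moves
  the absolute value `|ι ·|_{v₀}` of `k(ζ)`;
* (C3) `ι_u (γ a)` is the `ℓ`-th power of an element fixed by the stabiliser of `ι_u ζ`, for all
  `u ∈ V` and all `γ ∈ Γ_K`;
* (C4) `ρ a > 0` for every real embedding `ρ` of `k(ζ)`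

(`exists_radicand`).  Proof: `a` is chosen `v₀`-adically close to a `b`-approximant at the
absolute value `|ι ·|_{v₀}`, and close to `1` at every other absolute value of `k(ζ)` above `v₀`,
at all absolute values above `V`, and at the real places (`exists_forall_spectralNorm_sub_lt`,
weak approximation); elements close to `1` (resp. to `b`) are `ℓ`-th powers (resp. `b` times
`ℓ`-th powers) in the relevant closed subfields of `\bar K_u` by
`exists_pos_forall_exists_mem_pow_eq` (Krasner-type root extraction).

## References

* H. Cohen, P. Stevenhagen, *Computational class field theory*, MSRI Publ. 44 (2008), §5;
  J. Neukirch, *Algebraic Number Theory*, II (3.4) (approximation), II §5, VI §1.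
  [cite: BuhlerStevenhagen2008, §5 p. 532]
-/

noncomputable section

open scoped NumberField IntermediateField Valued
open Field IsDedekindDomain IntermediateField
open Literature.FieldTheory.Kummer

universe u

namespace Literature.NumberTheory.GaloisRepresentations

variable (K : Type u) [Field K] [NumberField K]

/-- The fixed field of `W = H ⊓ Z` contains `ι k(ζ)`; more precisely an element fixed by `W`
lies in `K_{v}(ι k(ζ)) = adjoin K_v (range (ι ∘ incl))`. [folklore] -/
theorem mem_adjoin_range_of_forall_smul_eq (v : HeightOneSpectrum (𝓞 K))
    (k : IntermediateField K (AlgebraicClosure K)) {ζg : AlgebraicClosure K}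
    {Z H : Subgroup (absoluteGaloisGroup (v.adicCompletion K))}
    (hZ : ∀ σ, σ ∈ Z ↔ σ • absClosureEmbedding K (v.adicCompletion K) ζg =
      absClosureEmbedding K (v.adicCompletion K) ζg)
    (hH : ∀ σ, σ ∈ H ↔ ∀ x ∈ k, σ • absClosureEmbedding K (v.adicCompletion K) x =
      absClosureEmbedding K (v.adicCompletion K) x)
    {y : AlgebraicClosure (v.adicCompletion K)} (hy : ∀ w ∈ H ⊓ Z, w • y = y) :
    y ∈ IntermediateField.adjoin (v.adicCompletion K)
      (Set.range ((absClosureEmbedding K (v.adicCompletion K)).comp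
        (((↥k)⟮ζg⟯).val.restrictScalars K))) := by
  haveI : CharZero (v.adicCompletion K) :=
    charZero_of_injective_algebraMap (algebraMap K _).injective
  set E := IntermediateField.adjoin (v.adicCompletion K)
      (absClosureEmbedding K (v.adicCompletion K) ''
        ((IntermediateField.restrictScalars K (↥k)⟮ζg⟯ : IntermediateField K (AlgebraicClosure K)) :
          Set (AlgebraicClosure K))) with hE
  have hrange : Set.range ((absClosureEmbedding K (v.adicCompletion K)).comp
      (((↥k)⟮ζg⟯).val.restrictScalars K)) =
      absClosureEmbedding K (v.adicCompletion K) ''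
        ((IntermediateField.restrictScalars K (↥k)⟮ζg⟯ : IntermediateField K (AlgebraicClosure K)) :
          Set (AlgebraicClosure K)) := by
    ext z
    simp only [Set.mem_range, Set.mem_image, AlgHom.coe_comp, Function.comp_apply,
      AlgHom.coe_restrictScalars', IntermediateField.coe_val, SetLike.mem_coe,
      IntermediateField.mem_restrictScalars]
    constructor
    · rintro ⟨x, rfl⟩
      exact ⟨x, x.2, rfl⟩
    · rintro ⟨x, hx, rfl⟩
      exact ⟨⟨x, hx⟩, rfl⟩
  rw [hrange, ← hE]
  -- `fixingSubgroup E = W` and `fixedField (fixingSubgroup E) = E`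
  have hfix : ∀ τ : AlgebraicClosure (v.adicCompletion K) ≃ₐ[v.adicCompletion K]
      AlgebraicClosure (v.adicCompletion K), τ ∈ E.fixingSubgroup → τ y = y := by
    intro τ hτ
    have h1 := (mem_fixingSubgroup_adjoin_image_iff K v
      (IntermediateField.restrictScalars K (↥k)⟮ζg⟯)
      ((absoluteGaloisGroup.toAlgEquiv (v.adicCompletion K)).symm τ)).1 hτ
    have h2 : (absoluteGaloisGroup.toAlgEquiv (v.adicCompletion K)).symm τ ∈ H ⊓ Z :=
      (mem_inf_iff_forall_smul_eq K v k hZ hH _).2 fun x hx => h1 x hx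
    exact hy _ h2
  have h3 : y ∈ IntermediateField.fixedField E.fixingSubgroup :=
    (IntermediateField.mem_fixedField_iff _ _).2 fun τ hτ => hfix τ hτ
  rwa [InfiniteGalois.fixedField_fixingSubgroup] at h3

/-- **Choice of the radicand.**  See the module docstring for (C1)–(C4).
Cohen–Stevenhagen, *Computational class field theory*, §5 (choice of `α` with prescribed local
behaviour by approximation). [cite: BuhlerStevenhagen2008, §5 p. 532] -/
theorem exists_radicand (v₀ : HeightOneSpectrum (𝓞 K))
    (k : IntermediateField K (AlgebraicClosure K)) [FiniteDimensional K k]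
    {ℓ : ℕ} (hℓ : ℓ.Prime) {ζg : AlgebraicClosure K} (hζg : IsPrimitiveRoot ζg ℓ)
    (hnormal : Normal K (IntermediateField.restrictScalars K (↥k)⟮ζg⟯))
    [FiniteDimensional (↥k) (↥k)⟮ζg⟯]
    {Z H H' : Subgroup (absoluteGaloisGroup (v₀.adicCompletion K))}
    (hZ : ∀ σ, σ ∈ Z ↔ σ • absClosureEmbedding K (v₀.adicCompletion K) ζg =
      absClosureEmbedding K (v₀.adicCompletion K) ζg)
    (hH : ∀ σ, σ ∈ H ↔ ∀ x ∈ k, σ • absClosureEmbedding K (v₀.adicCompletion K) x =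
      absClosureEmbedding K (v₀.adicCompletion K) x)
    (hle : H' ≤ H) (hnorm : ∀ h ∈ H, ∀ h' ∈ H', h * h' * h⁻¹ ∈ H') (hidx : H'.relIndex H = ℓ)
    {s : absoluteGaloisGroup (v₀.adicCompletion K)} (hs : s ∈ H ⊓ Z) (hs' : s ∉ H' ⊓ Z)
    {β : AlgebraicClosure (v₀.adicCompletion K)} (hβ0 : β ≠ 0) (hβW' : ∀ w ∈ H' ⊓ Z, w • β = β)
    (hsβ : s • β = absClosureEmbedding K (v₀.adicCompletion K) ζg * β)
    (V : Finset (HeightOneSpectrum (𝓞 K))) (hV : v₀ ∉ V)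
    (hsplit : ∀ u ∈ V, ∀ (σ : absoluteGaloisGroup (u.adicCompletion K)), ∀ x ∈ k,
      σ • absClosureEmbedding K (u.adicCompletion K) x = absClosureEmbedding K (u.adicCompletion K) x) :
    ∃ a : (↥k)⟮ζg⟯, (a : AlgebraicClosure K) ≠ 0 ∧
      (∃ y : AlgebraicClosure (v₀.adicCompletion K), y ≠ 0 ∧ (∀ w ∈ H ⊓ Z, w • y = y) ∧
        absClosureEmbedding K (v₀.adicCompletion K) a = β ^ ℓ * y ^ ℓ) ∧
      (∀ γ : absoluteGaloisGroup K, (∀ x ∈ k, γ • x = x) →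
        (∃ x ∈ (↥k)⟮ζg⟯,
          spectralNorm (v₀.adicCompletion K) (AlgebraicClosure (v₀.adicCompletion K))
              (absClosureEmbedding K (v₀.adicCompletion K) (γ • x)) ≠
            spectralNorm (v₀.adicCompletion K) (AlgebraicClosure (v₀.adicCompletion K))
              (absClosureEmbedding K (v₀.adicCompletion K) x)) →
        ∃ y : AlgebraicClosure (v₀.adicCompletion K), (∀ w ∈ H ⊓ Z, w • y = y) ∧
          absClosureEmbedding K (v₀.adicCompletion K) (γ • (a : AlgebraicClosure K)) = y ^ ℓ) ∧
      (∀ u ∈ V, ∀ γ : absoluteGaloisGroup K, ∃ z : AlgebraicClosure (u.adicCompletion K),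
        (∀ σ : absoluteGaloisGroup (u.adicCompletion K),
          σ • absClosureEmbedding K (u.adicCompletion K) ζg =
            absClosureEmbedding K (u.adicCompletion K) ζg → σ • z = z) ∧
        absClosureEmbedding K (u.adicCompletion K) (γ • (a : AlgebraicClosure K)) = z ^ ℓ) ∧
      (∀ ρ : (↥k)⟮ζg⟯ →+* ℝ, 0 < ρ a) := by
  classical
  haveI : NeZero ℓ := ⟨hℓ.ne_zero⟩
  haveI := hnormal
  -- the number field `E = k(ζ)` over `K`
  haveI : FiniteDimensional K (↥k)⟮ζg⟯ := Module.Finite.trans (↥k) (↥k)⟮ζg⟯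
  -- spectral norms: notation-free helpers
  have hcz : ∀ u : HeightOneSpectrum (𝓞 K), CharZero (u.adicCompletion K) := fun u =>
    charZero_of_injective_algebraMap (algebraMap K _).injective
  have hℓ0 : ∀ u : HeightOneSpectrum (𝓞 K),
      ((ℓ : ℕ) : AlgebraicClosure (u.adicCompletion K)) ≠ 0 := fun u => by
    haveI : CharZero (AlgebraicClosure (u.adicCompletion K)) :=
      charZero_of_injective_algebraMap (algebraMap K _).injective
    exact Nat.cast_ne_zero.2 hℓ.ne_zero
  haveI : CharZero (v₀.adicCompletion K) := hcz v₀
  -- Krasner-type constants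
  have hroot : ∀ u : HeightOneSpectrum (𝓞 K), ∃ δ : ℝ, 0 < δ ∧
      ∀ (E : IntermediateField (u.adicCompletion K) (AlgebraicClosure (u.adicCompletion K)))
        (y : AlgebraicClosure (u.adicCompletion K)), y ∈ E →
        spectralNorm (u.adicCompletion K) (AlgebraicClosure (u.adicCompletion K)) (y - 1) < δ →
        ∃ z ∈ E, z ^ ℓ = y := fun u => by
    haveI := hcz u
    exact exists_pos_forall_exists_mem_pow_eq hℓ (hℓ0 u)
  choose δ hδ hroot using hroot
  -- the embeddings `ι_u ∘ γ` of `E` and the reference embedding `ι₀ = ι_{v₀}|_E`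
  set ιE : (u : HeightOneSpectrum (𝓞 K)) → absoluteGaloisGroup K →
      ((↥k)⟮ζg⟯ →ₐ[K] AlgebraicClosure (u.adicCompletion K)) := fun u γ =>
    (absClosureEmbedding K (u.adicCompletion K)).comp
      (((absoluteGaloisGroup.toAlgEquiv K γ : AlgebraicClosure K ≃ₐ[K] AlgebraicClosure K) :
        AlgebraicClosure K →ₐ[K] AlgebraicClosure K).comp (((↥k)⟮ζg⟯).val.restrictScalars K))
    with hιE
  have hιE_apply : ∀ u γ (x : (↥k)⟮ζg⟯), ιE u γ x =
      absClosureEmbedding K (u.adicCompletion K) (γ • (x : AlgebraicClosure K)) := fun u γ x => rfl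
  set ι₀ : (↥k)⟮ζg⟯ →ₐ[K] AlgebraicClosure (v₀.adicCompletion K) :=
    (absClosureEmbedding K (v₀.adicCompletion K)).comp (((↥k)⟮ζg⟯).val.restrictScalars K) with hι₀
  have hι₀_apply : ∀ x : (↥k)⟮ζg⟯, ι₀ x =
      absClosureEmbedding K (v₀.adicCompletion K) (x : AlgebraicClosure K) := fun x => rfl
  -- `W`-basics at `v₀`
  have hζ : IsPrimitiveRoot (absClosureEmbedding K (v₀.adicCompletion K) ζg) ℓ :=
    hζg.map_of_injective (absClosureEmbedding K (v₀.adicCompletion K)).injective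
  have hW'W : H' ⊓ Z ≤ H ⊓ Z := inf_le_inf_right Z hle
  have hζW : ∀ w ∈ H ⊓ Z, w • absClosureEmbedding K (v₀.adicCompletion K) ζg =
      absClosureEmbedding K (v₀.adicCompletion K) ζg := fun w hw => (hZ w).1 hw.2
  have hnormW : ∀ w ∈ H ⊓ Z, ∀ w' ∈ H' ⊓ Z, w * w' * w⁻¹ ∈ H' ⊓ Z := fun w hw w' hw' =>
    conj_mem_inf_of_mem_inf (v₀.adicCompletion K) hℓ hζ hZ hnorm hw hw'
  have hidxW := (relIndex_inf_eq_of_prime (v₀.adicCompletion K) hℓ hζ hZ hle hnorm hidx).1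
  have hbW : ∀ w ∈ H ⊓ Z, w • β ^ ℓ = β ^ ℓ := fun w hw =>
    (apply_pow_eq_of_kummer (K₀ := v₀.adicCompletion K)
      (Ω := AlgebraicClosure (v₀.adicCompletion K)) hℓ hζ
      (W := (H ⊓ Z : Subgroup (AlgebraicClosure (v₀.adicCompletion K) ≃ₐ[v₀.adicCompletion K]
        AlgebraicClosure (v₀.adicCompletion K))))
      (W' := (H' ⊓ Z : Subgroup (AlgebraicClosure (v₀.adicCompletion K) ≃ₐ[v₀.adicCompletion K]
        AlgebraicClosure (v₀.adicCompletion K)))) hW'W hnormW hidxW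
      (s := absoluteGaloisGroup.toAlgEquiv (v₀.adicCompletion K) s) hs hs' hζW hβW' hsβ
      (w := absoluteGaloisGroup.toAlgEquiv (v₀.adicCompletion K) w) hw).2
  have hWE : ∀ w ∈ H ⊓ Z, ∀ x ∈ (↥k)⟮ζg⟯, w • absClosureEmbedding K (v₀.adicCompletion K) x =
      absClosureEmbedding K (v₀.adicCompletion K) x := fun w hw =>
    (mem_inf_iff_forall_smul_eq K v₀ k hZ hH w).1 hw
  -- the closed subfield `F_W = fixedField W` of `\bar K_{v₀}`
  set FW : IntermediateField (v₀.adicCompletion K) (AlgebraicClosure (v₀.adicCompletion K)) :=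
    IntermediateField.fixedField
      ((H ⊓ Z : Subgroup (absoluteGaloisGroup (v₀.adicCompletion K))) :
        Subgroup (AlgebraicClosure (v₀.adicCompletion K) ≃ₐ[v₀.adicCompletion K]
          AlgebraicClosure (v₀.adicCompletion K))) with hFW
  have hmemFW : ∀ y : AlgebraicClosure (v₀.adicCompletion K),
      y ∈ FW ↔ ∀ w ∈ H ⊓ Z, w • y = y := fun y => by
    rw [hFW, IntermediateField.mem_fixedField_iff]
    rfl
  -- positivity of `N b`
  have hb0 : β ^ ℓ ≠ 0 := pow_ne_zero _ hβ0
  have hNb : 0 < spectralNorm (v₀.adicCompletion K) (AlgebraicClosure (v₀.adicCompletion K))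
      (β ^ ℓ) := spectralNorm_zero_lt hb0 (Algebra.IsAlgebraic.isAlgebraic _)
  -- a `b`-approximant `t₀ ∈ E`
  set εb : ℝ := min (δ v₀ * spectralNorm (v₀.adicCompletion K)
      (AlgebraicClosure (v₀.adicCompletion K)) (β ^ ℓ))
    (spectralNorm (v₀.adicCompletion K) (AlgebraicClosure (v₀.adicCompletion K)) (β ^ ℓ)) with hεb
  have hεb0 : 0 < εb := lt_min (mul_pos (hδ v₀) hNb) hNb
  have hbadj : β ^ ℓ ∈ IntermediateField.adjoin (v₀.adicCompletion K) (Set.range ι₀) :=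
    mem_adjoin_range_of_forall_smul_eq K v₀ k hZ hH hbW
  obtain ⟨t₀, ht₀⟩ := exists_spectralNorm_sub_lt_of_mem_adjoin K v₀ ι₀ hbadj hεb0
  -- targets for the approximation theorem
  let cond : (u : HeightOneSpectrum (𝓞 K)) →
      ((↥k)⟮ζg⟯ →ₐ[K] AlgebraicClosure (u.adicCompletion K)) → Prop := fun u φ =>
    ∀ x : (↥k)⟮ζg⟯, spectralNorm (u.adicCompletion K) (AlgebraicClosure (u.adicCompletion K)) (φ x) =
      spectralNorm (v₀.adicCompletion K) (AlgebraicClosure (v₀.adicCompletion K)) (ι₀ x)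
  let t : (u : HeightOneSpectrum (𝓞 K)) →
      ((↥k)⟮ζg⟯ →ₐ[K] AlgebraicClosure (u.adicCompletion K)) → (↥k)⟮ζg⟯ := fun u φ =>
    if cond u φ then t₀ else 1
  have ht : ∀ u ∈ insert v₀ V, ∀ φ ψ : (↥k)⟮ζg⟯ →ₐ[K] AlgebraicClosure (u.adicCompletion K),
      (∀ x, spectralNorm (u.adicCompletion K) (AlgebraicClosure (u.adicCompletion K)) (φ x) =
        spectralNorm (u.adicCompletion K) (AlgebraicClosure (u.adicCompletion K)) (ψ x)) →
      t u φ = t u ψ := by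
    intro u _ φ ψ hφψ
    have hiff : cond u φ ↔ cond u ψ :=
      ⟨fun h x => (hφψ x).symm.trans (h x), fun h x => (hφψ x).trans (h x)⟩
    change (if cond u φ then t₀ else 1) = (if cond u ψ then t₀ else 1)
    by_cases hc : cond u φ
    · rw [if_pos hc, if_pos (hiff.1 hc)]
    · rw [if_neg hc, if_neg (fun h => hc (hiff.2 h))]
  -- the tolerance
  set εV : ℝ := (insert v₀ V).inf' ⟨v₀, Finset.mem_insert_self v₀ V⟩ δ with hεV
  have hεV0 : 0 < εV := (Finset.lt_inf'_iff _).2 fun u _ => hδ u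
  set ε : ℝ := min (min εb (δ v₀)) (min εV 1) with hε
  have hε0 : 0 < ε := lt_min (lt_min hεb0 (hδ v₀)) (lt_min hεV0 one_pos)
  have hεεb : ε ≤ εb := (min_le_left _ _).trans (min_le_left _ _)
  have hεδ : ε ≤ δ v₀ := (min_le_left _ _).trans (min_le_right _ _)
  have hεV' : ∀ u ∈ V, ε ≤ δ u := fun u hu =>
    ((min_le_right _ _).trans (min_le_left _ _)).trans
      (Finset.inf'_le _ (Finset.mem_insert_of_mem hu))
  have hε1 : ε ≤ 1 := (min_le_right _ _).trans (min_le_right _ _)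
  -- approximate
  obtain ⟨a, haS, haR⟩ := exists_forall_spectralNorm_sub_lt K (↥k)⟮ζg⟯ (insert v₀ V) t ht
    (fun _ => 1) hε0
  -- (A) `ι a` is `εb`-close to `b`
  have hcond₀ : cond v₀ ι₀ := fun x => rfl
  have hA : spectralNorm (v₀.adicCompletion K) (AlgebraicClosure (v₀.adicCompletion K))
      (ι₀ a - β ^ ℓ) < εb := by
    have h1 := haS v₀ (Finset.mem_insert_self v₀ V) ι₀
    have h2 : t v₀ ι₀ = t₀ := if_pos hcond₀
    rw [h2, map_sub] at h1
    have hna := isNonarchimedean_spectralNorm (K := v₀.adicCompletion K)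
      (L := AlgebraicClosure (v₀.adicCompletion K)) (ι₀ a - ι₀ t₀) (ι₀ t₀ - β ^ ℓ)
    rw [sub_add_sub_cancel] at hna
    exact hna.trans_lt (max_lt (h1.trans_le hεεb) ht₀)
  have hιa0 : ι₀ a ≠ 0 := by
    intro h0
    rw [h0, zero_sub, spectralNorm_neg (Algebra.IsAlgebraic.isAlgebraic _)] at hA
    exact (lt_irrefl _) (hA.trans_le (min_le_right _ _))
  have ha0 : (a : AlgebraicClosure K) ≠ 0 := fun h0 => hιa0 (by rw [hι₀_apply, h0, map_zero])
  refine ⟨a, ha0, ?_, ?_, ?_, ?_⟩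
  · -- (C1)
    have haFW : ι₀ a ∈ FW := (hmemFW _).2 fun w hw => hWE w hw a a.2
    have hbFW : β ^ ℓ ∈ FW := (hmemFW _).2 hbW
    have hy₀ : ι₀ a * (β ^ ℓ)⁻¹ ∈ FW := mul_mem haFW (inv_mem hbFW)
    have hy₀1 : spectralNorm (v₀.adicCompletion K) (AlgebraicClosure (v₀.adicCompletion K))
        (ι₀ a * (β ^ ℓ)⁻¹ - 1) < δ v₀ := by
      have h1 : ι₀ a * (β ^ ℓ)⁻¹ - 1 = (ι₀ a - β ^ ℓ) * (β ^ ℓ)⁻¹ := by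
        field_simp
      rw [h1, ← spectralMulAlgNorm_def, map_mul, map_inv₀, spectralMulAlgNorm_def,
        spectralMulAlgNorm_def]
      rw [mul_inv_lt_iff₀ hNb]
      exact hA.trans_le (min_le_left _ _)
    obtain ⟨z, hzFW, hz⟩ := hroot v₀ FW _ hy₀ hy₀1
    refine ⟨z, ?_, (hmemFW z).1 hzFW, ?_⟩
    · rintro rfl
      rw [zero_pow hℓ.ne_zero] at hz
      exact mul_ne_zero hιa0 (inv_ne_zero hb0) hz.symm
    · rw [← hι₀_apply, hz, mul_comm, inv_mul_cancel_right₀ hb0]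
  · -- (C2)
    intro γ _ hmove
    have hncond : ¬ cond v₀ (ιE v₀ γ) := by
      obtain ⟨x, hx, hne⟩ := hmove
      intro hc
      exact hne (by rw [← hιE_apply v₀ γ ⟨x, hx⟩, hc ⟨x, hx⟩, hι₀_apply])
    have h1 := haS v₀ (Finset.mem_insert_self v₀ V) (ιE v₀ γ)
    have h2 : t v₀ (ιE v₀ γ) = 1 := if_neg hncond
    rw [h2, map_sub, map_one, hιE_apply] at h1
    have hmem : absClosureEmbedding K (v₀.adicCompletion K) (γ • (a : AlgebraicClosure K)) ∈ FW :=
      (hmemFW _).2 fun w hw => hWE w hw _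
        (smul_mem_of_normal (IntermediateField.restrictScalars K (↥k)⟮ζg⟯) γ a.2)
    obtain ⟨z, hzFW, hz⟩ := hroot v₀ FW _ hmem (h1.trans_le hεδ)
    exact ⟨z, (hmemFW z).1 hzFW, hz.symm⟩
  · -- (C3)
    intro u hu γ
    have huv : u ≠ v₀ := fun h => hV (h ▸ hu)
    -- an element of `K` small at `v₀` but a unit at `u`
    have hncond : ¬ cond u (ιE u γ) := by
      intro hc
      have hne : v₀.asIdeal ≠ u.asIdeal := fun h => huv (HeightOneSpectrum.ext h).symm
      have hnot : ¬ v₀.asIdeal ≤ u.asIdeal := fun hle' =>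
        hne ((v₀.isPrime.isMaximal v₀.ne_bot).eq_of_le u.isPrime.ne_top hle')
      obtain ⟨r, hrv, hru⟩ := Set.not_subset.1 hnot
      have h1 := hc (algebraMap K (↥k)⟮ζg⟯ (algebraMap (𝓞 K) K r))
      rw [hιE_apply, hι₀_apply] at h1
      have h2 : ((algebraMap K (↥k)⟮ζg⟯ (algebraMap (𝓞 K) K r) : (↥k)⟮ζg⟯) : AlgebraicClosure K) =
          algebraMap K (AlgebraicClosure K) (algebraMap (𝓞 K) K r) := rfl
      rw [h2, absoluteGaloisGroup.smul_def, AlgEquiv.commutes, AlgHom.commutes, AlgHom.commutes,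
        IsScalarTower.algebraMap_apply K (u.adicCompletion K) (AlgebraicClosure (u.adicCompletion K)),
        IsScalarTower.algebraMap_apply K (v₀.adicCompletion K)
          (AlgebraicClosure (v₀.adicCompletion K)),
        spectralNorm_extends, spectralNorm_extends] at h1
      have h3 : ‖algebraMap K (u.adicCompletion K) (algebraMap (𝓞 K) K r)‖ = 1 := by
        rw [← IsScalarTower.algebraMap_apply]
        have h' := norm_algebraMap_ringOfIntegers_le_one K u r
        have h'' : ¬ ‖algebraMap (𝓞 K) (u.adicCompletion K) r‖ < 1 := by
          rw [norm_algebraMap_ringOfIntegers_lt_one_iff K u r]; exact hru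
        exact le_antisymm h' (not_lt.1 h'')
      have h4 : ‖algebraMap K (v₀.adicCompletion K) (algebraMap (𝓞 K) K r)‖ < 1 := by
        rw [← IsScalarTower.algebraMap_apply, norm_algebraMap_ringOfIntegers_lt_one_iff K v₀ r]
        exact hrv
      rw [h3] at h1
      exact (lt_irrefl (1 : ℝ)) (h1 ▸ h4)
    have h1 := haS u (Finset.mem_insert_of_mem hu) (ιE u γ)
    have h2 : t u (ιE u γ) = 1 := if_neg hncond
    rw [h2, map_sub, map_one, hιE_apply] at h1
    -- the closed subfield fixed by the stabiliser of `ι_u ζ`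
    set Zu : Subgroup (absoluteGaloisGroup (u.adicCompletion K)) :=
      MulAction.stabilizer (absoluteGaloisGroup (u.adicCompletion K))
        (absClosureEmbedding K (u.adicCompletion K) ζg) with hZu
    have hZu' : ∀ σ, σ ∈ Zu ↔ σ • absClosureEmbedding K (u.adicCompletion K) ζg =
        absClosureEmbedding K (u.adicCompletion K) ζg := fun σ => MulAction.mem_stabilizer_iff
    have hHu : ∀ σ, σ ∈ (⊤ : Subgroup (absoluteGaloisGroup (u.adicCompletion K))) ↔ ∀ x ∈ k,
        σ • absClosureEmbedding K (u.adicCompletion K) x =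
          absClosureEmbedding K (u.adicCompletion K) x :=
      fun σ => ⟨fun _ x hx => hsplit u hu σ x hx, fun _ => Subgroup.mem_top σ⟩
    set FZ : IntermediateField (u.adicCompletion K) (AlgebraicClosure (u.adicCompletion K)) :=
      IntermediateField.fixedField
        ((⊤ ⊓ Zu : Subgroup (absoluteGaloisGroup (u.adicCompletion K))) :
          Subgroup (AlgebraicClosure (u.adicCompletion K) ≃ₐ[u.adicCompletion K]
            AlgebraicClosure (u.adicCompletion K))) with hFZ
    have hmemFZ : ∀ y : AlgebraicClosure (u.adicCompletion K),
        y ∈ FZ ↔ ∀ w ∈ (⊤ ⊓ Zu : Subgroup (absoluteGaloisGroup (u.adicCompletion K))),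
          w • y = y := fun y => by
      rw [hFZ, IntermediateField.mem_fixedField_iff]
      rfl
    have hmem : absClosureEmbedding K (u.adicCompletion K) (γ • (a : AlgebraicClosure K)) ∈ FZ :=
      (hmemFZ _).2 fun w hw => (mem_inf_iff_forall_smul_eq K u k hZu' hHu w).1 hw _
        (smul_mem_of_normal (IntermediateField.restrictScalars K (↥k)⟮ζg⟯) γ a.2)
    obtain ⟨z, hzFZ, hz⟩ := hroot u FZ _ hmem (h1.trans_le (hεV' u hu))
    refine ⟨z, fun σ hσ => (hmemFZ z).1 hzFZ σ ⟨Subgroup.mem_top σ, (hZu' σ).2 hσ⟩, hz.symm⟩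
  · -- (C4)
    intro ρ
    have h1 := haR ρ
    rw [map_sub, map_one, abs_sub_lt_iff] at h1
    linarith [h1.2, hε1]

end Literature.NumberTheory.GaloisRepresentations
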